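import Summits.CriticalPhenomena.PercolationContinuityZ3.Theorems.PercNearOneGluingNoHeavyLowerTailFKCSHPhiMonotoneCluster
import Summits.CriticalPhenomena.PercolationContinuityZ3.Theorems.PercNearOneGluingNoHeavyLowerTailFKHtwFKHolds
import HarnessLib

/-!
# FK sub-lane: LEMMA Φ(b) FOR THE RANDOM-CLUSTER MEASURE — `FK.PhiFKMonotone q` holds for every `q ≥ 1`

Support file (`--supports stmt-CriticalPhenomena-4575`), FK sub-lane `prim-bschramm-fk-1` (gen 3) of the post-continuity programme;
builds on p205010 (kernel theorem, internal audit signed; external expert review pending).  No definitions, no named facts, no sorries;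
standard axioms.

MAIN THEOREM `FK.phiFKMonotone_of_one_le : 1 ≤ q → FK.PhiFKMonotone q` — the monotonicity half of Lemma Φ for `φ_{w,q}` (the located
open statement of the FK finite leg, fk-1 gen 2 `…FKCSHPhiDefs.lean`; census-clean for `q ≥ 1`, false for `q < 1`).  Proof = the
LOCKSTEP EXPLORATION (`…FKCSHPhiMonotoneDefs.lean` docstring): `FK.phase1` explores the cluster of `Y` under the two measures together,
`FK.phase2` explores the larger cluster together with the world sample of the smaller one, every step is a one-point decomposition
(`FK.rcE_opd`) + lockstep (`FK.lockstep2/3`, probabilities ordered by `FK.popen_mono`), and the leaves are dominations in the edge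
parameters (`FK.rcE_mono_weights`) after the island identity (`FK.rcE_island`).  General form: `FK.Th_anti` — `Θ_w(v') ≤ Θ_w(v)` whenever
`v ≤ v'` and `v ≤ w` (pointwise); `FK.phiFK_eq_Th` identifies `Φ_FK(K) = Θ_w(w − K̄)`.

COROLLARIES — THE FK FINITE LEG IS UNCONDITIONAL (with fk-2 gen 4's `FK.additiveGluingFK_of_phiFKMonotone`, i.e. (Htw)_FK =
`FK.htwFK_of_one_le` from T^S ≥ 0): `FK.cshFK_of_one_le : 1 ≤ q → FK.CSHFK q`, **`FK.additiveGluingFK_of_one_le : 1 ≤ q → FK.AdditiveGluingFK q`**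
(Kozma–Nitzan additive gluing for every random-cluster measure with `q ≥ 1` on every finite weighted graph), `FK.nearOneGluingFK_of_one_le`,
and the three conjecture nodes of `…FKAnalogues.lean` discharged by name: `FK.additiveGluingFKMonotone_holds`, `FK.additiveGluingFKTwo_holds`,
`FK.cshFKMonotone_holds`.
[cite: VandenbergHaggstromKahn2005, §2.1 (pp. 9–13)] [cite: Grimmett2006, Thm. (3.7) (p. 39); Thm. (3.21) (p. 44)] [cite: KozmaNitzan2024, Conj. 1 (p. 3), Conj. 4 (p. 32)]
-/

noncomputable section

namespace Summit.CriticalPhenomena.PercolationContinuityZ3.Theorems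

open MeasureTheory Set Literature.Probability.LatticeModels Literature.Probability.Percolation
open scoped Classical
open BHK2006 DecisionTree HullPort

namespace FK

variable {V : Type*} [Fintype V]

/-- One-point decomposition of `Θ_w`. [cite: Grimmett2006, Thm. (3.7) (p. 39)] -/
theorem Th_opd (w : Sym2 V → unitInterval) {q : ℝ} (hq : 0 < q) (x : V) (Y : Set V) (g : Set (Sym2 V) → ℝ)
    (v : Sym2 V → unitInterval) (f : Sym2 V) :
    Th w q x Y g v = popen v q f * Th w q x Y g (setW v f true) + (1 - popen v q f) * Th w q x Y g (setW v f false) :=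
  rcE_opd v hq f _

omit [Fintype V] in
/-- A revealed pair at the weight-1 cluster of `Y` lies in the cut of the enlarged cluster. [folklore] -/
theorem mem_cut_setW_true {Y : Set V} {v : Sym2 V → unitInterval} {f : Sym2 V} (hf : f ∈ cut Y (oneSet v)) :
    f ∈ cut Y (oneSet (setW v f true)) := by
  rw [oneSet_setW_true]; exact CSH.cut_mono Y (subset_insert _ _) hf

/-- **PHASE 2: base case** (every pair meeting the weight-1 cluster `W'` of `Y` for `v'` is determined): then `C_Y = W'` a.s. under
`φ_{v'}`, `Θ_w(v') = 1{x ∉ W'}(a_w(W') − E_{v'} g(C_x))`, and the claim follows from three dominations in the parameters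
(`vv ≤ v'`, `vv ≤ z`, `w − W̄' ≤ z`). [cite: Grimmett2006, Thm. (3.21) (p. 44)] [cite: VandenbergHaggstromKahn2005, §2.1 Lemma 2.3 (p. 10)] -/
theorem phase2_base (w : Sym2 V → unitInterval) {q : ℝ} (hq : 1 ≤ q) (x : V) (Y : Set V) {g : Set (Sym2 V) → ℝ} (hg : Monotone g)
    (vv v' z : Sym2 V → unitInterval) (hdet : ∀ f ∈ cut Y (oneSet v'), v' f = 0 ∨ v' f = 1)
    (J1 : ∀ e, vv e ≤ v' e) (J2 : ∀ e, vv e ≤ z e) (J3 : ∀ e, e ∉ cut Y (oneSet v') → z e = w e) :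
    Th w q x Y g v' ≤ rcE z q (Gx g x) - rcE vv q (Gx g x) := by
  have hq0 : 0 < q := one_pos.trans_le hq
  have hG := Gx_mono hg x
  have h1 : rcE vv q (Gx g x) ≤ rcE z q (Gx g x) := rcE_mono_weights J2 hq hG
  have h2 : rcE vv q (Gx g x) ≤ rcE v' q (Gx g x) := rcE_mono_weights J1 hq hG
  have h3 : rcE (delW w (cut Y (oneSet v'))) q (Gx g x) ≤ rcE z q (Gx g x) := by
    refine rcE_mono_weights (fun e => ?_) hq hG
    by_cases he : e ∈ cut Y (oneSet v')
    · simp only [delW, if_pos he]; exact unitInterval.nonneg _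
    · simp only [delW, if_neg he]; exact (J3 e he).symm.le
  rw [Th_base w hq0 x Y g v' hdet]
  by_cases hc : oneSet v' ∈ avoidEv x Y
  · rw [ind_of_mem hc, one_mul]; linarith
  · rw [ind_of_not_mem hc, zero_mul]; linarith

/-- **PHASE 2 of the lockstep exploration.**  For parameter vectors `vv ≤ v'`, `vv ≤ z` with `z = w` off the pairs meeting the weight-1
cluster of `Y` for `v'`:  `Θ_w(v') ≤ E_z g(C_x) − E_vv g(C_x)`.  Induction on the number of pairs not determined in all three vectors:
reveal a pair meeting the `v'`-cluster of `Y` in the three vectors at once (one-point decomposition ×3, lockstep of three bits with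
`φ_vv(f) ≤ φ_{v'}(f)`, `φ_vv(f) ≤ φ_z(f)`), or conclude by `FK.phase2_base`.
[cite: VandenbergHaggstromKahn2005, §2.1 pp. 10–12 (the Markov-chain coupling)] [cite: Grimmett2006, Thm. (3.7), Thm. (3.21)] -/
theorem phase2 (w : Sym2 V → unitInterval) {q : ℝ} (hq : 1 ≤ q) (x : V) (Y : Set V) {g : Set (Sym2 V) → ℝ} (hg : Monotone g) :
    ∀ (N : ℕ) (vv v' z : Sym2 V → unitInterval), (undet3 vv v' z).card ≤ N →
      (∀ e, vv e ≤ v' e) → (∀ e, vv e ≤ z e) → (∀ e, e ∉ cut Y (oneSet v') → z e = w e) →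
      Th w q x Y g v' ≤ rcE z q (Gx g x) - rcE vv q (Gx g x) := by
  have hq0 : 0 < q := one_pos.trans_le hq
  intro N
  induction N with
  | zero =>
    intro vv v' z hcard J1 J2 J3
    refine phase2_base w hq x Y hg vv v' z (fun f _ => ?_) J1 J2 J3
    have hf : f ∉ undet3 vv v' z := by
      rw [Nat.le_zero, Finset.card_eq_zero] at hcard; rw [hcard]; exact Finset.notMem_empty f
    rw [mem_undet3_iff, not_not] at hf
    exact hf.2.1
  | succ N ih =>
    intro vv v' z hcard J1 J2 J3
    by_cases hex : ∃ f ∈ cut Y (oneSet v'), f ∈ undet3 vv v' z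
    · obtain ⟨f, hfcut, hfund⟩ := hex
      -- reveal `f` in the three vectors at once
      have hcard' : ∀ b₁ b₂ b₃ : Bool, (undet3 (setW vv f b₁) (setW v' f b₂) (setW z f b₃)).card ≤ N := by
        intro b₁ b₂ b₃
        have h := Finset.card_le_card (undet3_setW_subset vv v' z f b₁ b₂ b₃)
        rw [Finset.card_erase_of_mem hfund] at h
        omega
      -- invariants after the step
      have hJ1 : ∀ {b₁ b₂ : Bool}, (b₁ = true → b₂ = true) → ∀ e, setW vv f b₁ e ≤ setW v' f b₂ e :=
        fun hb => setW_le_setW J1 f hb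
      have hJ2 : ∀ {b₁ b₃ : Bool}, (b₁ = true → b₃ = true) → ∀ e, setW vv f b₁ e ≤ setW z f b₃ e :=
        fun hb => setW_le_setW J2 f hb
      have hJ3true : ∀ b₃ : Bool, ∀ e, e ∉ cut Y (oneSet (setW v' f true)) → setW z f b₃ e = w e := by
        intro b₃ e he
        by_cases h : e = f
        · subst h; exact absurd (mem_cut_setW_true hfcut) he
        · rw [setW_ne z h]
          exact J3 e fun he' => he (by rw [oneSet_setW_true]; exact CSH.cut_mono Y (subset_insert _ _) he')
      have hJ3false : v' f ≠ 1 → ∀ b₃ : Bool, ∀ e, e ∉ cut Y (oneSet (setW v' f false)) → setW z f b₃ e = w e := by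
        intro hv1 b₃ e he
        rw [oneSet_setW_false v' hv1] at he
        by_cases h : e = f
        · subst h; exact absurd hfcut he
        · rw [setW_ne z h]; exact J3 e he
      -- the three open-pair probabilities, ordered
      have h0 := popen_nonneg vv hq0 f
      have h12 : popen vv q f ≤ popen v' q f := popen_mono J1 hq f
      have h13 : popen vv q f ≤ popen z q f := popen_mono J2 hq f
      have h2 := popen_le_one v' hq0 f
      have h3 := popen_le_one z hq0 f
      have hne1 : popen v' q f < 1 → v' f ≠ 1 := fun hlt hv1 => by
        rw [popen_eq_one hq0 hv1] at hlt; exact lt_irrefl _ hlt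
      rw [Th_opd w hq0 x Y g v' f, rcE_opd z hq0 f, rcE_opd vv hq0 f]
      have key := lockstep3 (Z₁ := rcE (setW z f true) q (Gx g x)) (Z₀ := rcE (setW z f false) q (Gx g x))
        (B₁ := rcE (setW vv f true) q (Gx g x)) (B₀ := rcE (setW vv f false) q (Gx g x))
        (C₁ := Th w q x Y g (setW v' f true)) (C₀ := Th w q x Y g (setW v' f false)) h0 h12 h13 h2 h3
        (fun _ => by
          have := ih _ _ _ (hcard' true true true) (hJ1 fun _ => rfl) (hJ2 fun _ => rfl) (hJ3true true)
          linarith)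
        (fun _ _ => by
          have := ih _ _ _ (hcard' false true true) (hJ1 fun h => absurd h Bool.false_ne_true)
            (hJ2 fun h => absurd h Bool.false_ne_true) (hJ3true true)
          linarith)
        (fun _ => by
          have := ih _ _ _ (hcard' false true false) (hJ1 fun h => absurd h Bool.false_ne_true)
            (hJ2 fun h => absurd h Bool.false_ne_true) (hJ3true false)
          linarith)
        (fun h23 => by
          have := ih _ _ _ (hcard' false false true) (hJ1 fun h => absurd h Bool.false_ne_true)
            (hJ2 fun h => absurd h Bool.false_ne_true) (hJ3false (hne1 (lt_of_lt_of_le h23 h3)) true)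
          linarith)
        (fun h21 _ => by
          have := ih _ _ _ (hcard' false false false) (hJ1 fun h => absurd h Bool.false_ne_true)
            (hJ2 fun h => absurd h Bool.false_ne_true) (hJ3false (hne1 h21) false)
          linarith)
      linarith
    · -- no undetermined pair meets the `v'`-cluster of `Y`: base case
      refine phase2_base w hq x Y hg vv v' z (fun f hf => ?_) J1 J2 J3
      have hf' : f ∉ undet3 vv v' z := fun h => hex ⟨f, hf, h⟩
      rw [mem_undet3_iff, not_not] at hf'
      exact hf'.2.1

/-- **PHASE 1: base case** (every pair meeting the weight-1 cluster `A` of `Y` for `v` is determined).  If `x ∈ A` both sides vanish;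
otherwise `Θ_w(v) = a_w(A) − E_v g(C_x) = E_{w − Ā} g(C_x) − E_{v − Ā} g(C_x)` by the ISLAND identity, and phase 2 applies with
`(vv, v', z) = (v − Ā, v', w − Ā)`. [cite: VandenbergHaggstromKahn2005, §2.1 Lemma 2.3 (p. 10)] -/
theorem phase1_base (w : Sym2 V → unitInterval) {q : ℝ} (hq : 1 ≤ q) (x : V) (Y : Set V) {g : Set (Sym2 V) → ℝ} (hg : Monotone g)
    (v v' : Sym2 V → unitInterval) (hdet : ∀ f ∈ cut Y (oneSet v), v f = 0 ∨ v f = 1)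
    (I1 : ∀ e, v e ≤ v' e) (I2 : ∀ e, e ∉ cut Y (oneSet v) → v e ≤ w e) :
    Th w q x Y g v' ≤ Th w q x Y g v := by
  have hq0 : 0 < q := one_pos.trans_le hq
  by_cases hxA : oneSet v ∈ avoidEv x Y
  · rw [Th_base w hq0 x Y g v hdet, ind_of_mem hxA, one_mul, rcE_island hq0 x Y g v hdet hxA]
    have hsub : cut Y (oneSet v) ⊆ cut Y (oneSet v') := CSH.cut_mono Y (oneSet_mono I1)
    refine phase2 w hq x Y hg _ (delW v (cut Y (oneSet v))) v' (delW w (cut Y (oneSet v))) le_rfl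
      (fun e => (delW_le v _ e).trans (I1 e)) (fun e => ?_) (fun e he => ?_)
    · by_cases h : e ∈ cut Y (oneSet v)
      · simp only [delW, if_pos h]; exact le_rfl
      · simp only [delW, if_neg h]; exact I2 e h
    · simp only [delW, if_neg (fun h => he (hsub h))]
  · rw [Th_eq_zero_of_reach w q x Y g I1 hxA, Th_eq_zero_of_reach w q x Y g (fun e => le_rfl) hxA]

/-- **PHASE 1 of the lockstep exploration**: for `v ≤ v'` with `v ≤ w` off the pairs meeting the weight-1 cluster of `Y` for `v`,
`Θ_w(v') ≤ Θ_w(v)`.  Induction on the number of undetermined pairs of `v`: reveal a pair meeting the `v`-cluster of `Y` in both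
vectors at once (one-point decomposition ×2, lockstep of two bits with `φ_v(f) ≤ φ_{v'}(f)`), or conclude by `FK.phase1_base`.
[cite: VandenbergHaggstromKahn2005, §2.1 pp. 10–12 (the Markov-chain coupling)] [cite: Grimmett2006, Thm. (3.7), Thm. (3.21)] -/
theorem phase1 (w : Sym2 V → unitInterval) {q : ℝ} (hq : 1 ≤ q) (x : V) (Y : Set V) {g : Set (Sym2 V) → ℝ} (hg : Monotone g) :
    ∀ (N : ℕ) (v v' : Sym2 V → unitInterval), (undet v).card ≤ N →
      (∀ e, v e ≤ v' e) → (∀ e, e ∉ cut Y (oneSet v) → v e ≤ w e) →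
      Th w q x Y g v' ≤ Th w q x Y g v := by
  have hq0 : 0 < q := one_pos.trans_le hq
  intro N
  induction N with
  | zero =>
    intro v v' hcard I1 I2
    refine phase1_base w hq x Y hg v v' (fun f _ => ?_) I1 I2
    have hf : f ∉ undet v := by
      rw [Nat.le_zero, Finset.card_eq_zero] at hcard; rw [hcard]; exact Finset.notMem_empty f
    rwa [mem_undet_iff, not_not] at hf
  | succ N ih =>
    intro v v' hcard I1 I2
    by_cases hex : ∃ f ∈ cut Y (oneSet v), f ∈ undet v
    · obtain ⟨f, hfcut, hfund⟩ := hex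
      have hv1 : v f ≠ 1 := fun h => ((mem_undet_iff v f).1 hfund) (Or.inr h)
      have hcard' : ∀ b : Bool, (undet (setW v f b)).card ≤ N := by
        intro b; have h := card_undet_setW_le v hfund b; omega
      have hI1 : ∀ {b₁ b₂ : Bool}, (b₁ = true → b₂ = true) → ∀ e, setW v f b₁ e ≤ setW v' f b₂ e :=
        fun hb => setW_le_setW I1 f hb
      have hI2 : ∀ b : Bool, ∀ e, e ∉ cut Y (oneSet (setW v f b)) → setW v f b e ≤ w e := by
        intro b e he
        have hsub : cut Y (oneSet v) ⊆ cut Y (oneSet (setW v f b)) := CSH.cut_mono Y (oneSet_subset_oneSet_setW v hv1 b)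
        by_cases h : e = f
        · subst h
          cases b
          · rw [setW_self]; exact unitInterval.nonneg _
          · exact absurd (mem_cut_setW_true hfcut) he
        · rw [setW_ne v h]; exact I2 e fun he' => he (hsub he')
      have h0 := popen_nonneg v hq0 f
      have h12 : popen v q f ≤ popen v' q f := popen_mono I1 hq f
      have h2 := popen_le_one v' hq0 f
      rw [Th_opd w hq0 x Y g v f, Th_opd w hq0 x Y g v' f]
      have key := lockstep2 (B₁ := Th w q x Y g (setW v f true)) (B₀ := Th w q x Y g (setW v f false))
        (C₁ := Th w q x Y g (setW v' f true)) (C₀ := Th w q x Y g (setW v' f false)) h0 h12 h2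
        (fun _ => by
          have := ih (setW v f true) (setW v' f true) (hcard' true) (hI1 (b₁ := true) (b₂ := true) fun _ => rfl) (hI2 true)
          linarith)
        (fun _ => by
          have := ih (setW v f false) (setW v' f true) (hcard' false)
            (hI1 (b₁ := false) (b₂ := true) fun h => absurd h Bool.false_ne_true) (hI2 false)
          linarith)
        (fun _ => by
          have := ih (setW v f false) (setW v' f false) (hcard' false)
            (hI1 (b₁ := false) (b₂ := false) fun h => absurd h Bool.false_ne_true) (hI2 false)
          linarith)
      linarith
    · refine phase1_base w hq x Y hg v v' (fun f hf => ?_) I1 I2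
      have hf' : f ∉ undet v := fun h => hex ⟨f, hf, h⟩
      rwa [mem_undet_iff, not_not] at hf'

/-- **`Θ_w` is antitone in the measure parameters below the world parameters**: `v ≤ v'` and `v ≤ w` imply `Θ_w(v') ≤ Θ_w(v)`.
This is the lockstep-exploration theorem: explore the cluster of `Y` under `φ_v` and `φ_{v'}` together (phase 1), then the larger
cluster together with the world sample of the smaller one (phase 2); all comparisons are dominations of random-cluster measures in
their edge parameters. [cite: VandenbergHaggstromKahn2005, §2.1 pp. 10–12] [cite: Grimmett2006, Thm. (3.7), Thm. (3.21)] -/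
theorem Th_anti (w : Sym2 V → unitInterval) {q : ℝ} (hq : 1 ≤ q) (x : V) (Y : Set V) {g : Set (Sym2 V) → ℝ} (hg : Monotone g)
    {v v' : Sym2 V → unitInterval} (hvv : ∀ e, v e ≤ v' e) (hvw : ∀ e, v e ≤ w e) :
    Th w q x Y g v' ≤ Th w q x Y g v :=
  phase1 w hq x Y hg _ v v' le_rfl hvv fun e _ => hvw e

/-- **`Φ_FK(K) = Θ_w(w − K̄)`**: the residual functional of the unfolding is `Θ_w` at the measure parameters `delW w (edgesOf K)`.
[cite: VandenbergHaggstromKahn2005, §2.1 Lemmas 2.3–2.4 (p. 10)] -/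
theorem phiFK_eq_Th (w : Sym2 V → unitInterval) {q : ℝ} (hq : 0 < q) (x : V) (Y : Set V) (g : Set (Sym2 V) → ℝ) (K : Set V) :
    phiFK w q x Y g K = Th w q x Y g (delW w (CSH.edgesOf K)) := by
  have hD : {ω : BondConfig V | ∀ y ∈ Y, ¬ (openGraph ω).Reachable x y} = avoidEv x Y := rfl
  have hwm : ∀ ω, worldMeanY w q x Y g ω = rcE (delW w (cut Y ω)) q (Gx g x) := by
    intro ω
    unfold worldMeanY rcE
    exact integral_rcMeasureW_eq_sum (delW w (cut Y ω)) hq (Gx g x)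
  unfold phiFK Th
  rw [hD, setIntegral_rcMeasureW_eq_sum _ hq]
  unfold rcE Xw
  refine Finset.sum_congr rfl fun ω _ => ?_
  rw [hwm ω]
  simp only [Gx]
  ring

/-- **LEMMA Φ(b) FOR THE RANDOM-CLUSTER MEASURE, `q ≥ 1`** — the located open statement of the FK finite leg is a THEOREM:
for every finite vertex type, every edge-parameter vector, every owner `x`, avoided set `Y` and monotone `g`, the residual functional
`K ↦ Φ_FK(K)` of the world-wise unfolding for `φ_{w,q}` is monotone.  Proof: `Φ_FK(K) = Θ_w(w − K̄)` and `Θ_w` is antitone in the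
measure parameters (`FK.Th_anti`, the lockstep exploration).  With `FK.additiveGluingFK_of_htwFK_of_phiFKMonotone` (fk-1 gen 2) the
FK finite leg `AdditiveGluingFK q` now rests on the single statement `FK.HtwFK q`; builds on p205010 (kernel theorem, internal audit
signed; external expert review pending). [cite: VandenbergHaggstromKahn2005, §2.1 (pp. 9–13)] [cite: Grimmett2006, Thm. (3.7), Thm. (3.21)] -/
theorem phiFKMonotone_of_one_le {q : ℝ} (hq : 1 ≤ q) : PhiFKMonotone q := by
  intro n w x Y g hg K K' hKK'
  have hq0 : 0 < q := one_pos.trans_le hq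
  rw [phiFK_eq_Th w hq0, phiFK_eq_Th w hq0]
  exact Th_anti w hq x Y hg (fun e => delW_anti w (CSH.edgesOf_mono hKK') e) (fun e => delW_le w _ e)

/-! ### Corollaries: the FK finite leg is UNCONDITIONAL for every `q ≥ 1` -/

/-- **CSH_FK for every `q ≥ 1`** — the conditioned slack hierarchy for the random-cluster measure `φ_{w,q}` on every finite weighted graph:
fk-2 gen 4's `FK.cshFK_of_phiFKMonotone` ((Htw)_FK = `FK.htwFK_of_one_le`, T^S ≥ 0) with Lemma Φ(b)_FK discharged here.
[cite: VandenbergHaggstromKahn2005, §2.1 (pp. 9–13)] [cite: KozmaNitzan2024, Conj. 4 (p. 32)] -/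
theorem cshFK_of_one_le {q : ℝ} (hq : 1 ≤ q) : CSHFK q :=
  cshFK_of_phiFKMonotone hq (phiFKMonotone_of_one_le hq)

/-- **KOZMA–NITZAN ADDITIVE GLUING FOR EVERY RANDOM-CLUSTER MEASURE `φ_{w,q}`, `q ≥ 1`, ON EVERY FINITE WEIGHTED GRAPH** —
`FK.AdditiveGluingFK q` unconditionally: fk-2 gen 4's `FK.additiveGluingFK_of_phiFKMonotone` with Lemma Φ(b)_FK discharged by
`FK.phiFKMonotone_of_one_le`.  (`q = 1` is the crux `AdditiveGluing` of p205010; builds on p205010 (kernel theorem, internal audit signed;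
external expert review pending).) [cite: KozmaNitzan2024, Conj. 1 (p. 3)] -/
theorem additiveGluingFK_of_one_le {q : ℝ} (hq : 1 ≤ q) : AdditiveGluingFK q :=
  additiveGluingFK_of_phiFKMonotone hq (phiFKMonotone_of_one_le hq)

/-- Near-one gluing (Kozma–Nitzan's Conj. 3 shape) for every `φ_{w,q}`, `q ≥ 1`. [cite: KozmaNitzan2024, Conj. 1 (p. 3)] -/
theorem nearOneGluingFK_of_one_le {q : ℝ} (hq : 1 ≤ q) : NearOneGluingFK q :=
  nearOneGluingFK_of_phiFKMonotone hq (phiFKMonotone_of_one_le hq)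

/-- **The conjecture node `FK.AdditiveGluingFKMonotone` (`∀ q ≥ 1, AdditiveGluingFK q`, fk-1 gen 1, `…FKAnalogues.lean`) is PROVED.**
[cite: KozmaNitzan2024, Conj. 1 (p. 3)] -/
theorem additiveGluingFKMonotone_holds : AdditiveGluingFKMonotone := fun _ hq => additiveGluingFK_of_one_le hq

/-- **The conjecture node `FK.AdditiveGluingFKTwo` (the `q = 2` / FK-Ising finite leg) is PROVED.** [cite: KozmaNitzan2024, Conj. 1 (p. 3)] -/
theorem additiveGluingFKTwo_holds : AdditiveGluingFKTwo := additiveGluingFK_of_one_le (by norm_num)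

/-- **The conjecture node `FK.CSHFKMonotone` (`∀ q ≥ 1, CSHFK q`) is PROVED.** [cite: VandenbergHaggstromKahn2005, §2.1 (pp. 9–13)] -/
theorem cshFKMonotone_holds : CSHFKMonotone := fun _ hq => cshFK_of_one_le hq

end FK

end Summit.CriticalPhenomena.PercolationContinuityZ3.Theorems

end
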